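import Summits.BirchSwinnertonDyer.Rank1Residual.Additive.KatoDescentKummerUnramifiedMordellWeil
import Summits.BirchSwinnertonDyer.Rank1Residual.Additive.KatoDescentKummerUnramifiedCompactBridge
import HarnessLib

set_option autoImplicit false

/-!
# (R1-d) COMPLETED ON THE ROWS: `[S_Σ : Sel_{p^∞}(E/ℚ)] · p^a = ∏_{ℓ∈Σ} p^{v_p(c_ℓ)}`, with `p^a = [ℤ_p κ_∞(P) : 𝔥]` the lattice
# exponent of Part 21 — the COMPACT SIDE of the passage `k → ∞`
# (seat `bsd-cm-prr-ty1` g11, cell `bsd-cm`; theorems only: no definition, no named fact, no instance, no `sorry`)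

Part 30 of the seat's kernel cut of stub 3 `stub_rankOneCountReadingKato` of the Kato–Perrin-Riou skeletons v4 (cruxes
stmt-BirchSwinnertonDyer-19945 / -19223; = cell bsd-potss's held input 27322).  Parts 22–27: for `k ≫ 0`,
`[S_Σ : Sel_{p^∞}] · [Sel^{(p^k)} : H¹_{𝓚⊓ur@Σ}] = ∏_{v∈Σ} p^{v_p(c_v)}`; Part 28: the second factor is `[M_k : M_k ⊓ H¹_{𝓚⊓ur@Σ}]`,
`M_k = ι_k⁻¹ κ_k(E(K))`; Part 29: `p^j • κ_∞(P)` is integral iff the finite-level classes `κ_{p^k}(p^j • P)` are unramified at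
`Σ` for all large `k`; Part 21: `H¹(ℤ[1/p], T_pW) = ℤ_p ∙ p^a κ_∞(P)` with `p^j • κ_∞(P)` integral iff `a ≤ j`.  THIS FILE assembles:

* §1 (any number field `K`; the Literature's classical group law on `E(K)`) `exists_kummerMapLevel_eq_zsmul` — if `P`
  generates `E(K)` modulo torsion then every level-`k` Kummer class is `n • κ_k(P)` (torsion dies in `E(K) ⊗ ℚ_p/ℤ_p`,
  `kummerMapLevel_eq_zero_of_isOfFinAddOrder`); `geomPrimaryTorsion_eq_zero_of_forall_smul_eq_of_forall` (no fixed
  `p`-torsion ⟹ no fixed `p^∞`-torsion); **`comap_range_kummerMapLevel_eq_zmultiples`: `M_k = ℤ · κ_{p^k}(P)`** when moreover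
  `E[p^∞]^{Γ_K} = 0` (`ι_k` injective).
* §2 (rows over `ℚ`) `kummerMapTorsion_mem_selmerGroup_iff_forall` (a Kummer class lies in `H¹_{𝓚⊓ur@Σ}` iff it is unramified
  at `Σ`); **`exists_relIndex_eq_pow_and_mem_and_min`** — for `k ≥ 1` and `𝓖'` of the shape: `[M_k : M_k ⊓ H¹_{𝓖'}] = p^b` for
  the least `b` with `κ_{p^k}(p^b • P) ∈ H¹_{𝓖'}`, and `b ≤ a` (Part 29 ⟹ `κ_{p^k}(p^a • P) ∈ H¹_{𝓖'}`; Part 29's cyclic index);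
* §3 **`exists_relIndex_selmerGroup_eq_pow_and_mul_eq`** — THE ROWS' (R1-d): for `W/ℚ` globally minimal of rank `1` generated by
  `P` modulo torsion, `Ш[p^∞]` finite, `p ∤ #W(ℚ)_tors`, `p` odd, `Σ ⊆ T` the additive places `≠ p` containing every bad `ℓ ≠ p`
  (`T ⊇ {p} ∪ bad`), and `x = κ_∞(P)` (`ofTop(red_{p^k} x) = κ_{p^k}(P)`): `∃ a`, `H¹(ℤ[1/p], T_pW) = ℤ_p ∙ (p^a • x)`, `∃ S_Σ` (THE
  relaxed-unramified subgroup, `Sel_{p^∞} ≤ S_Σ`, finite index), `∃ k₀ ≥ 1 ∀ k ≥ k₀ ∀ 𝓖'`: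
  **`[Sel^{(p^k)}(E/ℚ) : H¹_{𝓖'}(ℚ, E[p^k])] = p^a`** and **`[S_Σ : Sel_{p^∞}(E/ℚ)] · p^a = ∏_{ℓ∈Σ} p^{v_p(c_ℓ)}`** — stabilisation:
  Part 27's product pins `p^{b_k}` independently of `k` and `𝓖'`, so Part 29's converse applies with one exponent.

HONEST LABEL: theorems only; no stub or item is closed; nothing is registered; nothing is asserted on 19945 / 19223;
Kato's Main Conjecture and Perrin-Riou's conjecture are not touched; BSD is not proved for any curve.

References: [Kato2004Asterisque] §14.1 (p. 235), §14.8 (p. 238), (14.9.3) (p. 240), §14.18 (p. 244); [Rubin2000] Thm. 1.7.3;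
[GreenbergLNM1716] §2, §5; [MilneADT2006] Ch. I Prop. 3.8, Thm. 4.10; [SilvermanAEC2009] VIII.§2, X.§4.
-/

noncomputable section

open scoped Classical NumberField ContRepresentation

open WeierstrassCurve Field IsDedekindDomain NumberField CategoryTheory Literature.NumberTheory.EllipticCurves
  Literature.NumberTheory.EllipticCurves.Kato2004 Literature.NumberTheory.GaloisRepresentations
  Literature.NumberTheory.EllipticCurves.Kato2004.EulerSystemValues
  Literature.NumberTheory.GaloisRepresentations.DiscreteGaloisModule
open WeierstrassCurve (geomPoints geomTorsion galH1Torsion kummerMapTorsion)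
open Summit.BirchSwinnertonDyer.Rank1Residual.X11b.Levels Summit.BirchSwinnertonDyer.Rank1Residual.X11b.LocBridge
open Summit.BirchSwinnertonDyer.Rank1Residual.Additive.GlobalKummer
open Summit.BirchSwinnertonDyer.Rank1Residual.Additive.LevelBridge

universe u

namespace Summit.BirchSwinnertonDyer.Rank1Residual.Additive.KummerUnramified

/-! ## §1 `M_k = ℤ · κ_{p^k}(P)` when `P` generates `E(K)` modulo torsion and `E[p^∞]^{Γ_K} = 0` -/

section MordellWeil

variable {K : Type u} [Field K] [NumberField K] (W : WeierstrassCurve K) [W.IsElliptic] (p : ℕ) [hp : Fact p.Prime]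

omit [NumberField K] in
/-- **Every level-`k` Kummer class is an integer multiple of `κ_k(P)`** when `P` generates `E(K)` modulo torsion (the
torsion dies in `E(K) ⊗ ℚ_p/ℤ_p`: `kummerMapLevel_eq_zero_of_isOfFinAddOrder`). [cite: GreenbergLNM1716, §2 (p. 62)] -/
theorem exists_kummerMapLevel_eq_zsmul {P : W.toAffine.Point}
    (hgen : ∀ R : W.toAffine.Point, ∃ n : ℤ, IsOfFinAddOrder (R - n • P)) (k : ℕ) (R : W.toAffine.Point) :
    ∃ n : ℤ, kummerMapLevel W p W.zsmul_geomPoints_surjective_holds k R =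
      n • kummerMapLevel W p W.zsmul_geomPoints_surjective_holds k P := by
  obtain ⟨n, hn⟩ := hgen R
  refine ⟨n, ?_⟩
  have h0 := kummerMapLevel_eq_zero_of_isOfFinAddOrder W p W.zsmul_geomPoints_surjective_holds k hn
  rwa [(kummerMapLevel W p W.zsmul_geomPoints_surjective_holds k).map_sub, map_zsmul, sub_eq_zero] at h0

omit [NumberField K] [W.IsElliptic] hp in
/-- **No fixed `p`-torsion ⟹ no fixed `p^∞`-torsion** in `E(K̄)` (peel off one `p` at a time). [cite: GreenbergLNM1716, §2 p. 63] -/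
theorem geomPrimaryTorsion_eq_zero_of_forall_smul_eq_of_forall
    (hp1 : ∀ T : geomTorsion W (p : ℤ), (∀ σ : absoluteGaloisGroup K, σ • (T : geomPoints W) = T) → (T : geomPoints W) = 0)
    (Q : W.geomPrimaryTorsion p) (hQ : ∀ σ : absoluteGaloisGroup K, primaryGaloisModule W p σ Q = Q) : Q = 0 := by
  have key : ∀ (m : ℕ) (R : geomPoints W), (∀ σ : absoluteGaloisGroup K, σ • R = R) → ((p : ℤ) ^ m) • R = 0 → R = 0 := by
    intro m
    induction m with
    | zero => intro R _ h; simpa using h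
    | succ m ih =>
      intro R hfix h
      have hpR : ∀ σ : absoluteGaloisGroup K, σ • ((p : ℤ) • R) = (p : ℤ) • R := fun σ => by
        rw [smul_zsmul_geomPoints, hfix σ]
      have hm : ((p : ℤ) ^ m) • ((p : ℤ) • R) = 0 := by rw [smul_smul, ← pow_succ, h]
      have hpR0 : (p : ℤ) • R = 0 := ih _ hpR hm
      exact hp1 ⟨R, (W.mem_geomTorsion_iff (p : ℤ) R).mpr hpR0⟩ hfix
  obtain ⟨m, hm⟩ := (AddCommGroup.mem_primaryComponent (G := geomPoints W) (p := p)).mp Q.2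
  have hfix : ∀ σ : absoluteGaloisGroup K, σ • (Q : geomPoints W) = Q := fun σ =>
    congrArg (fun T : W.geomPrimaryTorsion p => (T : geomPoints W)) (hQ σ)
  exact Subtype.ext (key m Q hfix (by rw [← natCast_zsmul, Nat.cast_pow] at hm; exact hm))

omit [NumberField K] in
/-- **`M_k = ι_k⁻¹ κ_k(E(K)) = ℤ · κ_{p^k}(P)`** when `P` generates `E(K)` modulo torsion and `E[p^∞]^{Γ_K} = 0` (so `ι_k` is
injective; `ι_k κ_{p^k}(P) = κ_k(P)`, Part `KummerLevelClassBridge`). [cite: GreenbergLNM1716, §2 (pp. 62–63)] -/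
theorem comap_range_kummerMapLevel_eq_zmultiples {P : W.toAffine.Point}
    (hgen : ∀ R : W.toAffine.Point, ∃ n : ℤ, IsOfFinAddOrder (R - n • P))
    (hΓ : ∀ Q : W.geomPrimaryTorsion p, (∀ σ : absoluteGaloisGroup K, primaryGaloisModule W p σ Q = Q) → Q = 0) (k : ℕ) :
    ((kummerMapLevel W p W.zsmul_geomPoints_surjective_holds k).range).comap
        (galoisCohomology.map (primaryInclusion W p k) 1 : galH1Torsion W ((p ^ k : ℕ) : ℤ) →+ W.galH1Primary p) =
      AddSubgroup.zmultiples
        (kummerMapTorsion W ((p ^ k : ℕ) : ℤ)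
          (W.zsmul_geomPoints_surjective_holds (by exact_mod_cast pow_ne_zero k hp.out.ne_zero)) P) := by
  have hinj := map_primaryInclusion_injective W p k hΓ
  have hy := map_primaryInclusion_kummerMapTorsion_eq_kummerMapLevel W p W.zsmul_geomPoints_surjective_holds k P
  refine le_antisymm ?_ (AddSubgroup.zmultiples_le.mpr ?_)
  · intro z hz
    obtain ⟨R, hR⟩ := AddSubgroup.mem_comap.1 hz
    obtain ⟨n, hn⟩ := exists_kummerMapLevel_eq_zsmul W p hgen k R
    refine AddSubgroup.mem_zmultiples_iff.2 ⟨n, hinj ?_⟩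
    change galoisCohomology.map (primaryInclusion W p k) 1 (n • _) = galoisCohomology.map (primaryInclusion W p k) 1 z
    rw [map_zsmul, hy]
    exact hn.symm.trans hR
  · exact ⟨P, hy.symm⟩

end MordellWeil

/-! ## §2 Rows over `ℚ`: `[M_k : M_k ⊓ H¹_{𝓚⊓ur@Σ}] = p^b`, `b` the least exponent with `κ_{p^k}(p^b • P) ∈ H¹_{𝓚⊓ur@Σ}`, and `b ≤ a` -/

section Rows

variable (W : WeierstrassCurve ℚ) [W.IsElliptic] (p : ℕ) [hp : Fact p.Prime]

/-- A level-`p^k` Kummer class lies in `H¹_{𝓖'}` (`𝓖'` = «`𝓚 ⊓ H¹_ur` at `Σ`, `𝓚` elsewhere») iff it is unramified at `Σ`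
(it is Kummer everywhere, `kummerMapTorsion_mem_selmerLocalKer`). [cite: SilvermanAEC2009, X.§4 Thm. 4.2] -/
theorem kummerMapTorsion_mem_selmerGroup_iff_forall (k : ℕ) (Q : Finset (HeightOneSpectrum (𝓞 ℚ)))
    (𝓖' : SelmerStructure (W.torsionGaloisModule ((p ^ k : ℕ) : ℤ)))
    (h𝓖'Q : ∀ v ∈ Q, 𝓖' (Sum.inr v) = W.kummerSelmerStructure ((p ^ k : ℕ) : ℤ) (Sum.inr v) ⊓
      unramifiedSubgroup (GaloisRep.toLocal v (W.torsionGaloisModule ((p ^ k : ℕ) : ℤ))) 1)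
    (h𝓖'nQ : ∀ v ∉ Q, 𝓖' (Sum.inr v) = W.kummerSelmerStructure ((p ^ k : ℕ) : ℤ) (Sum.inr v))
    (h𝓖'inl : ∀ w : InfinitePlace ℚ, 𝓖' (Sum.inl w) = W.kummerSelmerStructure ((p ^ k : ℕ) : ℤ) (Sum.inl w))
    (R : W.toAffine.Point) :
    kummerMapTorsion W ((p ^ k : ℕ) : ℤ) (zsmul_natCast_pow_surjective W p k) R ∈ 𝓖'.selmerGroup ↔
      ∀ v ∈ Q, galoisCohomology.localization (W.torsionGaloisModule ((p ^ k : ℕ) : ℤ)) (Sum.inr v) 1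
          (kummerMapTorsion W ((p ^ k : ℕ) : ℤ) (zsmul_natCast_pow_surjective W p k) R) ∈
        unramifiedSubgroup (GaloisRep.toLocal v (W.torsionGaloisModule ((p ^ k : ℕ) : ℤ))) 1 := by
  have hkum : ∀ u : Place ℚ, galoisCohomology.localization (W.torsionGaloisModule ((p ^ k : ℕ) : ℤ)) u 1
      (kummerMapTorsion W ((p ^ k : ℕ) : ℤ) (zsmul_natCast_pow_surjective W p k) R) ∈
      W.kummerSelmerStructure ((p ^ k : ℕ) : ℤ) u := fun u =>
    AddSubgroup.mem_comap.1 ((SetLike.ext_iff.mp (W.comap_localization_kummerSelmerStructure ((p ^ k : ℕ) : ℤ) u) _).2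
      (kummerMapTorsion_mem_selmerLocalKer W _ _ (Place.Completion u) R))
  refine ⟨fun h v hv => ?_, fun h => (SelmerStructure.mem_selmerGroup_iff _ _).2 fun u => ?_⟩
  · have h' := (SelmerStructure.mem_selmerGroup_iff _ _).1 h (Sum.inr v)
    rw [h𝓖'Q v hv] at h'
    exact h'.2
  · rcases u with w | v
    · rw [h𝓖'inl w]; exact hkum _
    · by_cases hv : v ∈ Q
      · rw [h𝓖'Q v hv]; exact ⟨hkum _, h v hv⟩
      · rw [h𝓖'nQ v hv]; exact hkum _

variable [ContinuousSMul ℤ_[p] (W.tateModule p)]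

/-- **`[ℤ·κ_{p^k}(P) : ℤ·κ_{p^k}(P) ⊓ H¹_{𝓖'}] = p^b` with `b` the least exponent such that `κ_{p^k}(p^b • P) ∈ H¹_{𝓖'}`,
and `b ≤ a`** whenever `p^a • x` is integral (`x = κ_∞(P)`; Part 29 puts `κ_{p^k}(p^a • P)` in `H¹_{𝓖'}`, Part 29's cyclic index
does the count). [cite: Kato2004Asterisque, §14.1 (p. 235)] [cite: GreenbergLNM1716, §2 (pp. 62–63)] -/
theorem exists_relIndex_zmultiples_eq_pow_and_mem_and_min {P : W.toAffine.Point} {x : H1 (tateRep W p) ⊤}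
    (hx : ∀ j : ℕ,
      (ofTopSubgroup (W.torsionGaloisModule ((p : ℤ) ^ j)).toTopRep 1).hom (reduceH1Pk W p j ⊤ x) =
        kummerMapTorsion W ((p : ℤ) ^ j) (zsmul_pow_surjective W p j) P)
    {a : ℕ} (ha : p ^ a • x ∈ integralH1 (tateRep W p) p ⊤) (Q : Finset (HeightOneSpectrum (𝓞 ℚ)))
    (hQp : ∀ v ∈ Q, ((Rat.HeightOneSpectrum.primesEquiv v : Nat.Primes) : ℕ) ≠ p) (k : ℕ)
    (𝓖' : SelmerStructure (W.torsionGaloisModule ((p ^ k : ℕ) : ℤ)))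
    (h𝓖'Q : ∀ v ∈ Q, 𝓖' (Sum.inr v) = W.kummerSelmerStructure ((p ^ k : ℕ) : ℤ) (Sum.inr v) ⊓
      unramifiedSubgroup (GaloisRep.toLocal v (W.torsionGaloisModule ((p ^ k : ℕ) : ℤ))) 1)
    (h𝓖'nQ : ∀ v ∉ Q, 𝓖' (Sum.inr v) = W.kummerSelmerStructure ((p ^ k : ℕ) : ℤ) (Sum.inr v))
    (h𝓖'inl : ∀ w : InfinitePlace ℚ, 𝓖' (Sum.inl w) = W.kummerSelmerStructure ((p ^ k : ℕ) : ℤ) (Sum.inl w)) :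
    ∃ b : ℕ,
      𝓖'.selmerGroup.relIndex
          (AddSubgroup.zmultiples (kummerMapTorsion W ((p ^ k : ℕ) : ℤ) (zsmul_natCast_pow_surjective W p k) P)) = p ^ b ∧
      kummerMapTorsion W ((p ^ k : ℕ) : ℤ) (zsmul_natCast_pow_surjective W p k) (p ^ b • P) ∈ 𝓖'.selmerGroup ∧
      (∀ j : ℕ, kummerMapTorsion W ((p ^ k : ℕ) : ℤ) (zsmul_natCast_pow_surjective W p k) (p ^ j • P) ∈ 𝓖'.selmerGroup →
        b ≤ j) ∧ b ≤ a := by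
  have hmem : ∀ j : ℕ, kummerMapTorsion W ((p ^ k : ℕ) : ℤ) (zsmul_natCast_pow_surjective W p k) (p ^ j • P) ∈
      𝓖'.selmerGroup ↔ p ^ j • kummerMapTorsion W ((p ^ k : ℕ) : ℤ) (zsmul_natCast_pow_surjective W p k) P ∈
      𝓖'.selmerGroup := fun j => by rw [kummerMapTorsion_nsmul']
  have haU : kummerMapTorsion W ((p ^ k : ℕ) : ℤ) (zsmul_natCast_pow_surjective W p k) (p ^ a • P) ∈ 𝓖'.selmerGroup :=
    (kummerMapTorsion_mem_selmerGroup_iff_forall W p k Q 𝓖' h𝓖'Q h𝓖'nQ h𝓖'inl _).2 fun v hv =>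
      localization_kummerMapTorsion_nsmul_mem_unramifiedSubgroup_of_mem_integralH1 W p hx ha k (hQp v hv)
  have hex : ∃ j : ℕ, p ^ j • kummerMapTorsion W ((p ^ k : ℕ) : ℤ) (zsmul_natCast_pow_surjective W p k) P ∈
      𝓖'.selmerGroup := ⟨a, (hmem a).1 haU⟩
  refine ⟨Nat.find hex, relIndex_zmultiples_eq_pow _ _ hp.out ((hmem a).1 haU) _ (Nat.find_spec hex)
    (fun j hj => Nat.find_min' hex hj), (hmem _).2 (Nat.find_spec hex),
    fun j hj => Nat.find_min' hex ((hmem j).1 hj), Nat.find_min' hex ((hmem a).1 haU)⟩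

end Rows

/-! ## §3 (R1-d) on the rows: `[Sel^{(p^k)} : H¹_{𝓚⊓ur@Σ}] = p^a` for `k ≫ 0` and `[S_Σ : Sel_{p^∞}] · p^a = ∏_{ℓ∈Σ} p^{v_p(c_ℓ)}` -/

section Assembly

variable (W : WeierstrassCurve ℚ) [W.IsElliptic] [W.IsGloballyMinimal] (p : ℕ) [hp : Fact p.Prime]
  [ContinuousSMul ℤ_[p] (W.tateModule p)]

/-- **(R1-d) ON THE ROWS, COMPACT SIDE INCLUDED.**  `W/ℚ` globally minimal, `rank_ℤ W(ℚ) = 1` generated by `P` modulo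
torsion, `Ш(W/ℚ)[p^∞]` finite, `p ∤ #W(ℚ)_tors`, `p` odd; `x ∈ H¹(ℚ, T_pW)` with `ofTop(red_{p^k} x) = κ_{p^k}(P)` (`x = κ_∞(P)`,
Part 12); `Σ ⊆ T` finite sets of places, every `ℓ ∈ Σ` ADDITIVE and `≠ p`, every bad `ℓ ≠ p` in `Σ`, `T ⊇ {p} ∪ {bad}`.  THEN:
`∃ a`, `H¹(ℤ[1/p], T_pW) = ℤ_p ∙ (p^a • x)` (Part 21's `a`), `∃ S_Σ` = THE subgroup of `H¹(ℚ, E[p^∞])` «`p^∞`-Selmer off `Σ`,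
unramified at `Σ`» (Kato's `S(T)`) with `Sel_{p^∞} ≤ S_Σ`, and
**`[S_Σ : Sel_{p^∞}(E/ℚ)] · p^a = ∏_{ℓ∈Σ} p^{v_p(c_ℓ)}`**, **`∃ k₀ ≥ 1 ∀ k ≥ k₀ ∀ 𝓖': [Sel^{(p^k)}(E/ℚ) : H¹_{𝓖'}(ℚ, E[p^k])] = p^a`**.
This is the potss memo's (R1-d) «`#(S(T)/E(ℚ)⊗ℚ_p/ℤ_p) = #Ш[p^∞] · C′ / p^a`» in index form (`Sel_{p^∞}/E⊗ = Ш[p^∞]`).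
[cite: Kato2004Asterisque, §14.1 (p. 235), §14.8 (p. 238) and (14.9.3) (p. 240)] [cite: Rubin2000, Thm. 1.7.3]
[cite: GreenbergLNM1716, §2, §5] [cite: MilneADT2006, Ch. I Prop. 3.8] -/
theorem exists_relIndex_selmerGroup_eq_pow_and_mul_eq (hodd : p ≠ 2) (hrank : W.mordellWeilRank = 1)
    (hsha : Finite (AddCommGroup.primaryComponent W.sha p)) (htors : ¬ p ∣ W.torsionOrder) {P : W.toAffine.Point}
    (hgen : ∀ R : W.toAffine.Point, ∃ n : ℤ, IsOfFinAddOrder (R - n • P)) {x : H1 (tateRep W p) ⊤}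
    (hx : ∀ j : ℕ,
      (ofTopSubgroup (W.torsionGaloisModule ((p : ℤ) ^ j)).toTopRep 1).hom (reduceH1Pk W p j ⊤ x) =
        kummerMapTorsion W ((p : ℤ) ^ j) (zsmul_pow_surjective W p j) P)
    (Q T : Finset (HeightOneSpectrum (𝓞 ℚ))) (hQT : Q ⊆ T)
    (hQp : ∀ v ∈ Q, ((Rat.HeightOneSpectrum.primesEquiv v : Nat.Primes) : ℕ) ≠ p)
    (hQadd : ∀ v ∈ Q, W.HasAdditiveReductionAt v)
    (hQbad : ∀ v : HeightOneSpectrum (𝓞 ℚ), v ∈ W.badPlaces (𝓞 ℚ) →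
      ((Rat.HeightOneSpectrum.primesEquiv v : Nat.Primes) : ℕ) ≠ p → v ∈ Q)
    (hTp : ∀ v : HeightOneSpectrum (𝓞 ℚ), ((p : ℕ) : 𝓞 ℚ) ∈ v.asIdeal → v ∈ T)
    (hTbad : ∀ v : HeightOneSpectrum (𝓞 ℚ), ¬ W.HasGoodReductionAt v → v ∈ T) :
    ∃ a : ℕ, integralH1 (tateRep W p) p ⊤ = ℤ_[p] ∙ (p ^ a • x) ∧
    ∃ S : AddSubgroup (W.galH1Primary p),
      (∀ y, y ∈ S ↔
        (∀ v : HeightOneSpectrum (𝓞 ℚ), v ∉ Q → y ∈ selmerLocalKerPrimary W (v.adicCompletion ℚ) p) ∧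
        (∀ w : InfinitePlace ℚ, y ∈ selmerLocalKerPrimary W w.Completion p) ∧
        (∀ v ∈ Q, galoisCohomology.localization (primaryGaloisModule W p) (Sum.inr v) 1 y ∈
          unramifiedSubgroup (GaloisRep.toLocal v (primaryGaloisModule W p)) 1)) ∧
      selmerGroupPInfty W p ≤ S ∧ (selmerGroupPInfty W p).relIndex S ≠ 0 ∧
      (selmerGroupPInfty W p).relIndex S * p ^ a =
        ∏ v ∈ Q, p ^ padicValNat p ((W.baseChange (v.adicCompletion ℚ)).localTamagawaNumber (v.adicCompletionIntegers ℚ)) ∧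
      ∃ k₀ : ℕ, 1 ≤ k₀ ∧ ∀ k, k₀ ≤ k →
        ∀ (𝓖' : SelmerStructure (W.torsionGaloisModule ((p ^ k : ℕ) : ℤ))),
          (∀ v ∈ Q, 𝓖' (Sum.inr v) = W.kummerSelmerStructure ((p ^ k : ℕ) : ℤ) (Sum.inr v) ⊓
            unramifiedSubgroup (GaloisRep.toLocal v (W.torsionGaloisModule ((p ^ k : ℕ) : ℤ))) 1) →
          (∀ v ∉ Q, 𝓖' (Sum.inr v) = W.kummerSelmerStructure ((p ^ k : ℕ) : ℤ) (Sum.inr v)) →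
          (∀ w : InfinitePlace ℚ, 𝓖' (Sum.inl w) = W.kummerSelmerStructure ((p ^ k : ℕ) : ℤ) (Sum.inl w)) →
          𝓖'.selmerGroup.relIndex (W.kummerSelmerStructure ((p ^ k : ℕ) : ℤ)).selmerGroup = p ^ a := by
  haveI := hsha
  have hp' : p.Prime := hp.out
  obtain ⟨a, hA, hiff⟩ := exists_integralH1_eq_span_pow_smul W p hrank hsha htors hgen hx
  have hQp' : ∀ v ∈ Q, ((p : ℕ) : 𝓞 ℚ) ∉ v.asIdeal := fun v hv =>
    WeierstrassCurve.natCast_not_mem_asIdeal_of_primesEquiv_ne hp' (hQp v hv)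
  -- Part 27: `S_Σ`, `Sel_{p^∞} ≤ S_Σ`, the product identity for `k ≥ k₀`
  obtain ⟨S, hS, hle, hne, k₀, hk₀, hprod⟩ :=
    exists_addSubgroup_selmerGroupPInfty_le_and_relIndex_mul_eq W p hodd Q T hQT hQp' hQadd hTp hTbad
  -- Part 28: the exponent killing `Ш[p^∞]`
  obtain ⟨e, he⟩ := exists_forall_pow_smul_mem_ker_primaryH1ToH1 W p
  -- the two `DecidableEq ℚ` instances behind the group law on `W(ℚ)` (ambient / the Literature's classical one) agree
  have hdec : (instDecidableEqRat : DecidableEq ℚ) = fun a b => Classical.propDecidable (a = b) := Subsingleton.elim _ _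
  -- no fixed `p^∞`-torsion, hence `ι_k` injective and `M_k = ℤ · κ_{p^k}(P)` (§1)
  have hΓ : ∀ Qt : W.geomPrimaryTorsion p,
      (∀ σ : absoluteGaloisGroup ℚ, primaryGaloisModule W p σ Qt = Qt) → Qt = 0 :=
    geomPrimaryTorsion_eq_zero_of_forall_smul_eq_of_forall W p
      (fun T hT => LocPKummer.geomTorsion_eq_zero_of_forall_smul_eq_of_not_dvd_torsionOrder W p htors T hT)
  have hM := comap_range_kummerMapLevel_eq_zmultiples W p (P := P)
    (fun R => by obtain ⟨n, hn⟩ := hgen R; rw [hdec] at hn; exact ⟨n, hn⟩) hΓ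
  -- the canonical structure `𝓖₀ k` of the shape at each level
  let 𝓖₀ : ∀ k : ℕ, SelmerStructure (W.torsionGaloisModule ((p ^ k : ℕ) : ℤ)) := fun k u =>
    match u with
    | Sum.inl w => W.kummerSelmerStructure ((p ^ k : ℕ) : ℤ) (Sum.inl w)
    | Sum.inr v => if v ∈ Q then W.kummerSelmerStructure ((p ^ k : ℕ) : ℤ) (Sum.inr v) ⊓
        unramifiedSubgroup (GaloisRep.toLocal v (W.torsionGaloisModule ((p ^ k : ℕ) : ℤ))) 1
        else W.kummerSelmerStructure ((p ^ k : ℕ) : ℤ) (Sum.inr v)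
  have h𝓖₀Q : ∀ k, ∀ v ∈ Q, 𝓖₀ k (Sum.inr v) = W.kummerSelmerStructure ((p ^ k : ℕ) : ℤ) (Sum.inr v) ⊓
      unramifiedSubgroup (GaloisRep.toLocal v (W.torsionGaloisModule ((p ^ k : ℕ) : ℤ))) 1 := fun k v hv => by
    change (if v ∈ Q then _ else _) = _; rw [if_pos hv]
  have h𝓖₀nQ : ∀ k, ∀ v ∉ Q, 𝓖₀ k (Sum.inr v) = W.kummerSelmerStructure ((p ^ k : ℕ) : ℤ) (Sum.inr v) :=
    fun k v hv => by change (if v ∈ Q then _ else _) = _; rw [if_neg hv]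
  -- at every level `k ≥ K₀` and every structure of the shape: one exponent `b` with `[S:Sel] · p^b = C`, minimal, `≤ a`
  obtain ⟨K₀, hK₁, hK₂⟩ : ∃ K₀ : ℕ, k₀ ≤ K₀ ∧ e + 1 ≤ K₀ := ⟨max k₀ (e + 1), le_max_left _ _, le_max_right _ _⟩
  have hdata : ∀ k, K₀ ≤ k → ∀ (𝓖' : SelmerStructure (W.torsionGaloisModule ((p ^ k : ℕ) : ℤ))),
      (∀ v ∈ Q, 𝓖' (Sum.inr v) = W.kummerSelmerStructure ((p ^ k : ℕ) : ℤ) (Sum.inr v) ⊓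
        unramifiedSubgroup (GaloisRep.toLocal v (W.torsionGaloisModule ((p ^ k : ℕ) : ℤ))) 1) →
      (∀ v ∉ Q, 𝓖' (Sum.inr v) = W.kummerSelmerStructure ((p ^ k : ℕ) : ℤ) (Sum.inr v)) →
      (∀ w : InfinitePlace ℚ, 𝓖' (Sum.inl w) = W.kummerSelmerStructure ((p ^ k : ℕ) : ℤ) (Sum.inl w)) →
      ∃ b : ℕ, 𝓖'.selmerGroup.relIndex (W.kummerSelmerStructure ((p ^ k : ℕ) : ℤ)).selmerGroup = p ^ b ∧
        (selmerGroupPInfty W p).relIndex S * p ^ b =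
          ∏ v ∈ Q, p ^ padicValNat p
            ((W.baseChange (v.adicCompletion ℚ)).localTamagawaNumber (v.adicCompletionIntegers ℚ)) ∧
        kummerMapTorsion W ((p ^ k : ℕ) : ℤ) (zsmul_natCast_pow_surjective W p k) (p ^ b • P) ∈ 𝓖'.selmerGroup ∧ b ≤ a := by
    intro k hk 𝓖' h₁ h₂ h₃
    obtain ⟨b, hb, hbmem, -, hba⟩ := exists_relIndex_zmultiples_eq_pow_and_mem_and_min W p hx ((hiff a).2 le_rfl) Q hQp k
      𝓖' h₁ h₂ h₃
    have hSel : 𝓖'.selmerGroup.relIndex (W.kummerSelmerStructure ((p ^ k : ℕ) : ℤ)).selmerGroup = p ^ b := by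
      rw [relIndex_selmerGroup_eq_relIndex_comap_range_kummerMapLevel_of_le W p hodd Q hQp' hQadd e he k
        (hK₂.trans hk) 𝓖' h₁ h₂ h₃, hM k]
      exact hb
    refine ⟨b, hSel, ?_, hbmem, hba⟩
    rw [← hSel]
    exact hprod k (hK₁.trans hk) 𝓖' h₁ h₂ h₃
  -- the exponent at level `K₀` for the canonical structure
  obtain ⟨b₀, -, hb₀C, -, hb₀a⟩ := hdata K₀ le_rfl (𝓖₀ K₀) (h𝓖₀Q K₀) (h𝓖₀nQ K₀) (fun _ => rfl)
  -- all exponents agree with `b₀`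
  have hbeq : ∀ b : ℕ, (selmerGroupPInfty W p).relIndex S * p ^ b =
      ∏ v ∈ Q, p ^ padicValNat p ((W.baseChange (v.adicCompletion ℚ)).localTamagawaNumber (v.adicCompletionIntegers ℚ)) →
      b = b₀ := fun b hb =>
    Nat.pow_right_injective hp'.two_le (mul_left_cancel₀ hne (hb.trans hb₀C.symm))
  -- `a ≤ b₀`: Part 29's converse, fed by the canonical structures at all levels `≥ K₀`
  have hab : a ≤ b₀ := by
    refine (hiff b₀).1 (pow_smul_mem_integralH1_of_forall_localization_mem W p hx Q hQbad (j := b₀) (k₁ := K₀) ?_)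
    intro k hk v hv
    obtain ⟨b, -, hbC, hbmem, -⟩ := hdata k hk (𝓖₀ k) (h𝓖₀Q k) (h𝓖₀nQ k) (fun _ => rfl)
    obtain rfl : b = b₀ := hbeq b hbC
    exact (kummerMapTorsion_mem_selmerGroup_iff_forall W p k Q (𝓖₀ k) (h𝓖₀Q k) (h𝓖₀nQ k) (fun _ => rfl) _).1 hbmem v hv
  obtain rfl : b₀ = a := le_antisymm hb₀a hab
  refine ⟨b₀, hA, S, hS, hle, hne, hb₀C, K₀, hk₀.trans hK₁, fun k hk 𝓖' h₁ h₂ h₃ => ?_⟩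
  obtain ⟨b, hb, hbC, -, -⟩ := hdata k hk 𝓖' h₁ h₂ h₃
  obtain rfl : b = b₀ := hbeq b hbC
  exact hb

end Assembly



end Summit.BirchSwinnertonDyer.Rank1Residual.Additive.KummerUnramified

end
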